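import Mathlib
import HarnessLib
import Literature.MathematicalPhysics.QuantumFieldTheory.ConstructiveQFTWave0
import Summits.Ventures.LatticeQCDFlow.Scaling.SparsePatchSectors
import Summits.Ventures.LatticeQCDFlow.Scaling.SparsePatchSectorsLattice

/-!
# LatticeQCDFlow / Scaling — box coordinates, the axial gauge tree and the PEEL of a solid `l^d` box (v3.3, item 87a)

HONEST FRAMING: exact (Metropolis-corrected) sampling algorithms for lattice gauge theory; figures
of merit are autocorrelation/cost numbers at stated couplings and volumes; no continuum-physics
claim.

THEORY-2.md §3.3 / conjecture C7(b′), FOURTH STEP, combinatorial part: the certificate asked for by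
`Scaling/GaugeFixedPatchSectors*.lean`, for the SOLID BOX — the update set `boxLinks x₀ l` of ALL links
with both endpoints in `x₀ + {0,…,l-1}^d` (`3 ≤ l ≤ L - 1`), the update set of a block heat bath / a
block flow proposal with frozen exterior.

* `§1` box coordinates `coord x₀ x j = ((x - x₀) j).val` and their behaviour under `shift` / `unshift`;
  the sets `boxLinks`, `boxInterior` (sites all of whose `2d` links are updated), `boxTree x₀ l i₀`
  (axial links with interior upper endpoint — the gauge tree of `Scaling/BoxPatchSectors.lean`),
  `boxSurf` (face-parallel links in a face);
* `§2` the rank `boxRank`: `0` on face links, the height `coord i₀` on transverse links,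
  `(l - 2) + (l - 1 - coord i₁)` on axial links; `boxRank_le`: ranks are `≤ 2l - 4`;
* `§3` **`boxPeel`**: every link of `boxLinks \ boxTree` is a slot of a plaquette all of whose other
  slots in `boxLinks \ boxTree` have smaller rank — face links through the plaquette leaving the box,
  a transverse link at height `h ≥ 1` through the plaquette below it (whose axial slots are tree links
  unless they are face links), the top axial links (height `l - 2`) through the plaquette in direction
  `i₁`.

Purely combinatorial (no measure, no metric).  `def`s: `unshift`, `coord`, `boxLinks`, `boxInterior`,
`boxTree`, `boxSurf`, `boxRank`.  No sorry, no new axioms.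
-/

noncomputable section

open Set
open Literature.MathematicalPhysics.QuantumFieldTheory

namespace Summit.Ventures.LatticeQCDFlow.Theory2.Lattice

variable {d L : ℕ}

/-! ## §1. Box coordinates and box sets -/

/-- The neighbouring site `x - eᵢ`. [folklore] -/
def unshift (x : Site d L) (i : Fin d) : Site d L := x - Pi.single i 1

/-- `(x - e_i) + e_i = x`. [folklore] -/
theorem shift_unshift (x : Site d L) (i : Fin d) : (unshift x i).shift i = x := by
  simp only [unshift, Site.shift, sub_add_cancel]

/-- `(x + e_i) - e_i = x`. [folklore] -/
theorem unshift_shift (x : Site d L) (i : Fin d) : unshift (x.shift i) i = x := by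
  simp only [unshift, Site.shift, add_sub_cancel_right]

/-- Box coordinates relative to the corner `x₀`: `coord x₀ x j = ((x - x₀) j).val ∈ {0,…,L-1}`. [folklore] -/
def coord (x₀ x : Site d L) (j : Fin d) : ℕ := ((x - x₀) j).val

/-- Box coordinates are `< L`. [folklore] -/
theorem coord_lt [NeZero L] (x₀ x : Site d L) (j : Fin d) : coord x₀ x j < L := ZMod.val_lt _

/-- A shift in direction `i` does not change the other coordinates. [folklore] -/
theorem coord_shift_of_ne (x₀ x : Site d L) {i j : Fin d} (h : j ≠ i) :
    coord x₀ (x.shift i) j = coord x₀ x j := by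
  simp only [coord, Site.shift, Pi.sub_apply, Pi.add_apply, Pi.single_eq_of_ne h, add_zero]

/-- An unshift in direction `i` does not change the other coordinates. [folklore] -/
theorem coord_unshift_of_ne (x₀ x : Site d L) {i j : Fin d} (h : j ≠ i) :
    coord x₀ (unshift x i) j = coord x₀ x j := by
  simp only [coord, unshift, Pi.sub_apply, Pi.single_eq_of_ne h, sub_zero]

/-- A shift raises the coordinate by one (no wrap-around below `L - 1`). [folklore] -/
theorem coord_shift_self [NeZero L] (x₀ x : Site d L) (i : Fin d) (h : coord x₀ x i + 1 < L) :
    coord x₀ (x.shift i) i = coord x₀ x i + 1 := by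
  have h1 : (1 : ZMod L).val = 1 := by
    rw [ZMod.val_one_eq_one_mod]; exact Nat.mod_eq_of_lt (by omega)
  have key : (x.shift i - x₀) i = (x - x₀) i + 1 := by
    simp only [Site.shift, Pi.sub_apply, Pi.add_apply, Pi.single_eq_same]
    abel
  unfold coord at h ⊢
  rw [key, ZMod.val_add, h1, Nat.mod_eq_of_lt h]

/-- An unshift lowers a positive coordinate by one. [folklore] -/
theorem coord_unshift_self [NeZero L] (x₀ x : Site d L) (i : Fin d) (h : 1 ≤ coord x₀ x i) :
    coord x₀ (unshift x i) i = coord x₀ x i - 1 := by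
  have hL : 1 < L := lt_of_le_of_lt h (coord_lt x₀ x i)
  have h1 : (1 : ZMod L).val = 1 := by rw [ZMod.val_one_eq_one_mod]; exact Nat.mod_eq_of_lt hL
  have key : (unshift x i - x₀) i = (x - x₀) i - 1 := by
    simp only [unshift, Pi.sub_apply, Pi.single_eq_same]
    abel
  unfold coord at h ⊢
  rw [key, ZMod.val_sub (by rw [h1]; exact h), h1]

/-- An unshift from coordinate `0` wraps around to `L - 1`. [folklore] -/
theorem coord_unshift_of_eq_zero [NeZero L] (hL : 1 < L) (x₀ x : Site d L) (i : Fin d)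
    (h : coord x₀ x i = 0) : coord x₀ (unshift x i) i = L - 1 := by
  haveI : Fact (1 < L) := ⟨hL⟩
  unfold coord at h ⊢
  have h0 : (x - x₀) i = 0 := (ZMod.val_eq_zero _).1 h
  have key : (unshift x i - x₀) i = (x - x₀) i - 1 := by
    simp only [unshift, Pi.sub_apply, Pi.single_eq_same]
    abel
  rw [key, h0, zero_sub, ZMod.neg_val, if_neg one_ne_zero, ZMod.val_one]

/-- The update set of a BLOCK UPDATE of the solid box `x₀ + {0,…,l-1}^d`: all links whose both
endpoints lie in the box (`mem_boxLinks_iff`). [folklore] -/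
def boxLinks (x₀ : Site d L) (l : ℕ) : Set (Edge d L) :=
  {e | (∀ j, coord x₀ e.1 j < l) ∧ coord x₀ e.1 e.2 + 1 < l}

/-- `boxLinks` is the set of links with both endpoints in the box (`l + 1 ≤ L`). [folklore] -/
theorem mem_boxLinks_iff [NeZero L] {l : ℕ} (hlL : l + 1 ≤ L) (x₀ : Site d L) (e : Edge d L) :
    e ∈ boxLinks x₀ l ↔ (∀ j, coord x₀ e.1 j < l) ∧ ∀ j, coord x₀ (e.1.shift e.2) j < l := by
  constructor
  · rintro ⟨hB, hi⟩
    refine ⟨hB, fun j => ?_⟩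
    by_cases hj : j = e.2
    · rw [hj, coord_shift_self x₀ e.1 e.2 (by omega)]; exact hi
    · rw [coord_shift_of_ne x₀ e.1 hj]; exact hB j
  · rintro ⟨hB, hS⟩
    refine ⟨hB, ?_⟩
    have h := hS e.2
    have hB2 := hB e.2
    rw [coord_shift_self x₀ e.1 e.2 (by omega)] at h
    exact h

/-- Interior sites of the box: all `2d` incident links are updated. [folklore] -/
def boxInterior (x₀ : Site d L) (l : ℕ) : Set (Site d L) :=
  {x | ∀ j, 1 ≤ coord x₀ x j ∧ coord x₀ x j + 2 ≤ l}

/-- The axial gauge tree: axial (`i₀`-) links of the box whose upper endpoint is interior. [folklore] -/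
def boxTree (x₀ : Site d L) (l : ℕ) (i₀ : Fin d) : Set (Edge d L) :=
  {e | e.2 = i₀ ∧ coord x₀ e.1 i₀ + 3 ≤ l ∧ ∀ j, j ≠ i₀ → 1 ≤ coord x₀ e.1 j ∧ coord x₀ e.1 j + 2 ≤ l}

/-- Face links: parallel to and lying in a face of the box. [folklore] -/
def boxSurf (x₀ : Site d L) (l : ℕ) : Set (Edge d L) :=
  {e | ∃ j, j ≠ e.2 ∧ (coord x₀ e.1 j = 0 ∨ coord x₀ e.1 j + 1 = l)}

/-! ## §2. The peeling rank -/

open Classical in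
/-- The peeling rank of the box: `0` on face links, the height `coord i₀` on transverse links, and
`(l - 2) + (l - 1 - coord i₁)` on axial links. [folklore] -/
def boxRank (x₀ : Site d L) (l : ℕ) (i₀ i₁ : Fin d) (e : Edge d L) : ℕ :=
  if e ∈ boxSurf x₀ l then 0 else if e.2 = i₀ then (l - 2) + (l - 1 - coord x₀ e.1 i₁) else coord x₀ e.1 i₀

/-- Face links have rank `0`. [folklore] -/
theorem boxRank_of_surf {x₀ : Site d L} {l : ℕ} {i₀ i₁ : Fin d} {e : Edge d L} (h : e ∈ boxSurf x₀ l) :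
    boxRank x₀ l i₀ i₁ e = 0 := by
  unfold boxRank; rw [if_pos h]

/-- The rank of a transverse link is at most its height. [folklore] -/
theorem boxRank_le_coord {x₀ : Site d L} {l : ℕ} {i₀ i₁ : Fin d} {e : Edge d L} (h : e.2 ≠ i₀) :
    boxRank x₀ l i₀ i₁ e ≤ coord x₀ e.1 i₀ := by
  unfold boxRank
  by_cases hs : e ∈ boxSurf x₀ l
  · rw [if_pos hs]; exact Nat.zero_le _
  · rw [if_neg hs, if_neg h]

/-- The rank of an axial link is at most `(l - 2) + (l - 1 - coord i₁)`. [folklore] -/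
theorem boxRank_le_axial {x₀ : Site d L} {l : ℕ} {i₀ i₁ : Fin d} {e : Edge d L} (h : e.2 = i₀) :
    boxRank x₀ l i₀ i₁ e ≤ (l - 2) + (l - 1 - coord x₀ e.1 i₁) := by
  unfold boxRank
  by_cases hs : e ∈ boxSurf x₀ l
  · rw [if_pos hs]; exact Nat.zero_le _
  · rw [if_neg hs, if_pos h]

/-- The rank of a non-face axial link. [folklore] -/
theorem boxRank_of_not_surf_axial {x₀ : Site d L} {l : ℕ} {i₀ i₁ : Fin d} {e : Edge d L}
    (hs : ¬ e ∈ boxSurf x₀ l) (h : e.2 = i₀) :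
    boxRank x₀ l i₀ i₁ e = (l - 2) + (l - 1 - coord x₀ e.1 i₁) := by
  unfold boxRank; rw [if_neg hs, if_pos h]

/-- The rank of a non-face transverse link is its height. [folklore] -/
theorem boxRank_of_not_surf_trans {x₀ : Site d L} {l : ℕ} {i₀ i₁ : Fin d} {e : Edge d L}
    (hs : ¬ e ∈ boxSurf x₀ l) (h : e.2 ≠ i₀) : boxRank x₀ l i₀ i₁ e = coord x₀ e.1 i₀ := by
  unfold boxRank; rw [if_neg hs, if_neg h]

/-- The ranks on the box are `≤ 2l - 4`. [folklore] -/
theorem boxRank_le {x₀ : Site d L} {l : ℕ} (hl : 3 ≤ l) {i₀ i₁ : Fin d} (h01 : i₀ ≠ i₁) {e : Edge d L}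
    (he : e ∈ boxLinks x₀ l) : boxRank x₀ l i₀ i₁ e ≤ 2 * l - 4 := by
  obtain ⟨hB, hi⟩ := he
  unfold boxRank
  by_cases hs : e ∈ boxSurf x₀ l
  · rw [if_pos hs]; omega
  · rw [if_neg hs]
    simp only [boxSurf, mem_setOf_eq, not_exists, not_and, not_or] at hs
    by_cases h : e.2 = i₀
    · rw [if_pos h]
      have h1 := (hs i₁ (by rw [h]; exact h01.symm)).1
      omega
    · rw [if_neg h]
      have h1 := (hs i₀ (Ne.symm h)).2
      have h2 := hB i₀
      omega


/-! ## §3. The peel of the box -/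

/-- The plaquette ABOVE `(z, a)` in direction `b ≠ a`: its other slots are `(z+e_a, b)`, `(z+e_b, a)`,
`(z, b)`. [folklore] -/
theorem exists_slots_above (z : Site d L) {a b : Fin d} (hab : a ≠ b) :
    ∃ (p : Plaquette d L) (s : Fin 4), plaqSlot p s = (z, a) ∧ ∀ s', s' ≠ s →
      plaqSlot p s' = (z.shift a, b) ∨ plaqSlot p s' = (z.shift b, a) ∨ plaqSlot p s' = (z, b) := by
  rcases lt_or_gt_of_ne hab with h | h
  · refine ⟨(z, ⟨(a, b), h⟩), 0, rfl, fun s' hs' => ?_⟩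
    fin_cases s'
    · exact absurd rfl hs'
    · exact Or.inl rfl
    · exact Or.inr (Or.inl rfl)
    · exact Or.inr (Or.inr rfl)
  · refine ⟨(z, ⟨(b, a), h⟩), 3, rfl, fun s' hs' => ?_⟩
    fin_cases s'
    · exact Or.inr (Or.inr rfl)
    · exact Or.inr (Or.inl rfl)
    · exact Or.inl rfl
    · exact absurd rfl hs'

/-- The plaquette BELOW `(y+e_b, a)` in direction `b ≠ a` (based at `y`): its other slots are
`(y, a)`, `(y+e_a, b)`, `(y, b)`. [folklore] -/
theorem exists_slots_below (y : Site d L) {a b : Fin d} (hab : a ≠ b) :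
    ∃ (p : Plaquette d L) (s : Fin 4), plaqSlot p s = (y.shift b, a) ∧ ∀ s', s' ≠ s →
      plaqSlot p s' = (y, a) ∨ plaqSlot p s' = (y.shift a, b) ∨ plaqSlot p s' = (y, b) := by
  rcases lt_or_gt_of_ne hab with h | h
  · refine ⟨(y, ⟨(a, b), h⟩), 2, rfl, fun s' hs' => ?_⟩
    fin_cases s'
    · exact Or.inl rfl
    · exact Or.inr (Or.inl rfl)
    · exact absurd rfl hs'
    · exact Or.inr (Or.inr rfl)
  · refine ⟨(y, ⟨(b, a), h⟩), 1, rfl, fun s' hs' => ?_⟩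
    fin_cases s'
    · exact Or.inr (Or.inr rfl)
    · exact absurd rfl hs'
    · exact Or.inr (Or.inl rfl)
    · exact Or.inl rfl

/-- **The peel of the box**: `boxRank` ranks `boxLinks \ boxTree` (`3 ≤ l ≤ L - 1`, `i₀ ≠ i₁`). [folklore] -/
theorem boxPeel [NeZero L] {x₀ : Site d L} {l : ℕ} (hl : 3 ≤ l) (hlL : l + 1 ≤ L) {i₀ i₁ : Fin d}
    (h01 : i₀ ≠ i₁) :
    ∀ e ∈ boxLinks x₀ l \ boxTree x₀ l i₀, ∃ (p : Plaquette d L) (s : Fin 4), plaqSlot p s = e ∧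
      ∀ s', s' ≠ s → plaqSlot p s' ∈ boxLinks x₀ l \ boxTree x₀ l i₀ →
        boxRank x₀ l i₀ i₁ (plaqSlot p s') < boxRank x₀ l i₀ i₁ e := by
  have hL : 1 < L := by omega
  rintro ⟨z, i⟩ ⟨⟨hB, hi⟩, hT⟩
  simp only at hB hi
  by_cases hS : (z, i) ∈ boxSurf x₀ l
  · -- face links are exposed
    obtain ⟨j, hji, hj⟩ := hS
    simp only at hji hj
    rcases hj with hj0 | hjl
    · -- bottom `j`-face: the plaquette below, based outside the box
      obtain ⟨p, s, hps, hother⟩ := exists_slots_below (unshift z j) (Ne.symm hji)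
      rw [shift_unshift] at hps
      refine ⟨p, s, hps, fun s' hs' hmem => ?_⟩
      exfalso
      have hy : coord x₀ (unshift z j) j = L - 1 := coord_unshift_of_eq_zero hL x₀ z j hj0
      rcases hother s' hs' with h | h | h <;> rw [h] at hmem
      · have := hmem.1.1 j; simp only at this; omega
      · have := hmem.1.1 j; simp only at this
        rw [coord_shift_of_ne x₀ _ hji] at this; omega
      · have := hmem.1.1 j; simp only at this; omega
    · -- top `j`-face: the plaquette above leaves the box
      obtain ⟨p, s, hps, hother⟩ := exists_slots_above z (Ne.symm hji)
      refine ⟨p, s, hps, fun s' hs' hmem => ?_⟩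
      exfalso
      rcases hother s' hs' with h | h | h <;> rw [h] at hmem
      · have := hmem.1.2; simp only at this
        rw [coord_shift_of_ne x₀ _ hji] at this; omega
      · have := hmem.1.1 j; simp only at this
        rw [coord_shift_self x₀ z j (by omega)] at this; omega
      · have := hmem.1.2; simp only at this; omega
  · -- non-face links: all transverse coordinates are interior
    have hns : ∀ j, j ≠ i → 1 ≤ coord x₀ z j ∧ coord x₀ z j + 2 ≤ l := by
      intro j hj
      simp only [boxSurf, mem_setOf_eq, not_exists, not_and, not_or] at hS
      have h1 := hS j hj
      have h2 := hB j
      omega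
    by_cases hi0 : i = i₀
    · -- top axial links: read off along direction `i₁`
      subst hi0
      have hc : coord x₀ z i = l - 2 := by
        have h : ¬ (coord x₀ z i + 3 ≤ l) := fun h => hT ⟨rfl, h, hns⟩
        omega
      have hrk : boxRank x₀ l i i₁ (z, i) = (l - 2) + (l - 1 - coord x₀ z i₁) :=
        boxRank_of_not_surf_axial hS rfl
      have hc1 := hns i₁ h01.symm
      obtain ⟨p, s, hps, hother⟩ := exists_slots_above z h01
      refine ⟨p, s, hps, fun s' hs' _ => ?_⟩
      rw [hrk]
      rcases hother s' hs' with h | h | h <;> rw [h]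
      · -- `(z + e_{i₀}, i₁)` lies in the top face
        have hsurf : (z.shift i, i₁) ∈ boxSurf x₀ l :=
          ⟨i, h01, Or.inr (by simp only; rw [coord_shift_self x₀ z i (by omega)]; omega)⟩
        rw [boxRank_of_surf hsurf]; omega
      · -- `(z + e_{i₁}, i₀)`: the next top axial link
        have h1 := boxRank_le_axial (x₀ := x₀) (l := l) (i₀ := i) (i₁ := i₁) (e := (z.shift i₁, i)) rfl
        simp only at h1
        rw [coord_shift_self x₀ z i₁ (by omega)] at h1
        omega
      · -- `(z, i₁)`: a transverse link at height `l - 2`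
        have h1 := boxRank_le_coord (x₀ := x₀) (l := l) (i₀ := i) (i₁ := i₁) (e := (z, i₁)) h01.symm
        simp only at h1
        omega
    · -- transverse links at height `h ≥ 1`: read off by the plaquette below
      have hc0 := hns i₀ (Ne.symm hi0)
      have hrk : boxRank x₀ l i₀ i₁ (z, i) = coord x₀ z i₀ := boxRank_of_not_surf_trans hS hi0
      set y := unshift z i₀ with hy
      have hyz : y.shift i₀ = z := shift_unshift z i₀
      have hy0 : coord x₀ y i₀ = coord x₀ z i₀ - 1 := coord_unshift_self x₀ z i₀ hc0.1
      have hyj : ∀ j, j ≠ i₀ → coord x₀ y j = coord x₀ z j := fun j hj => coord_unshift_of_ne x₀ z hj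
      obtain ⟨p, s, hps, hother⟩ := exists_slots_below y hi0
      rw [hyz] at hps
      refine ⟨p, s, hps, fun s' hs' hmem => ?_⟩
      rw [hrk]
      rcases hother s' hs' with h | h | h <;> rw [h] at hmem ⊢
      · -- `(y, i)`: transverse, one level down
        have h1 := boxRank_le_coord (x₀ := x₀) (l := l) (i₀ := i₀) (i₁ := i₁) (e := (y, i)) hi0
        simp only at h1
        omega
      · -- `(y + e_i, i₀)`: axial; in `Λ'` only if it lies in the top `i`-face
        have hci : coord x₀ (y.shift i) i = coord x₀ z i + 1 := by
          rw [coord_shift_self x₀ y i (by rw [hyj i hi0]; omega), hyj i hi0]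
        have hsurf : (y.shift i, i₀) ∈ boxSurf x₀ l := by
          refine ⟨i, hi0, Or.inr ?_⟩
          simp only
          rw [hci]
          by_contra hne
          apply hmem.2
          refine ⟨rfl, ?_, fun j hj => ?_⟩
          · simp only; rw [coord_shift_of_ne x₀ y (Ne.symm hi0), hy0]; omega
          · simp only
            by_cases hji : j = i
            · rw [hji, hci]; omega
            · rw [coord_shift_of_ne x₀ y hji, hyj j hj]; exact hns j hji
        rw [boxRank_of_surf hsurf]; omega
      · -- `(y, i₀)`: axial, below; in `Λ'` only if it lies in the bottom `i`-face
        have hsurf : (y, i₀) ∈ boxSurf x₀ l := by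
          refine ⟨i, hi0, Or.inl ?_⟩
          simp only
          rw [hyj i hi0]
          by_contra hne
          apply hmem.2
          refine ⟨rfl, ?_, fun j hj => ?_⟩
          · simp only; rw [hy0]; omega
          · simp only
            by_cases hji : j = i
            · rw [hji, hyj i hi0]; omega
            · rw [hyj j hj]; exact hns j hji
        rw [boxRank_of_surf hsurf]; omega


end Summit.Ventures.LatticeQCDFlow.Theory2.Lattice
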